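import Summits.BirchSwinnertonDyer.BirchSwinnertonDyer.Theorems.ByReductionTypeAtTwoOrdKatoHalfIsogenyMu
import Summits.BirchSwinnertonDyer.BirchSwinnertonDyer.Theorems.ByReductionTypeAtTwoOrdEisensteinHalfShaIsogeny
import Summits.BirchSwinnertonDyer.BirchSwinnertonDyer.Theses.ByReductionTypeAtTwo
import Summits.BirchSwinnertonDyer.Rank1Residual.X5.TwoAdicTargetsPub
import Summits.BirchSwinnertonDyer.Rank1Residual.X2.IsogenyLineTypeGoodOrdinary
import Literature.NumberTheory.EllipticCurves.PAdicLFunctionIntegralityAtTwoAutoProofs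
import Literature.NumberTheory.EllipticCurves.CuspFormLFunctionLevelConductorProofs
import Literature.NumberTheory.EllipticCurves.ModularCurveManinSemistableBridgeProofs
import Literature.NumberTheory.EllipticCurves.ComplexMultiplicationLFunctionIsogenyHoldsProofs
import HarnessLib

/-!
# The `2`-adic ISOGENY FORMULA at analytic rank `0` and the ISOGENY TRANSPORT of the Kato half
# (route ByReductionTypeAtTwo, cruxes `OrdKatoHalfAtTwo` = item stmt-BirchSwinnertonDyer-19271 and
# `OrdKatoHalfAtTwoIso` = item 19573; seat bsd-2adic-ord GEN 7; file 2 of 2)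

HONEST FRAMING (cell `bsd-2adic`, HUMAN RULINGS D-0036/D-0074): THEOREMS ONLY — no definition, no named
fact, nothing asserted; every deep input is a displayed PUBLISHED fact of the tree (Greenberg 1999
Thm. 4.1 AT `2` as `X5.O1.TwoAdicEulerCharRankZero W 0`, Kato 2004 Thm. 17.4 (1)(2) AT `2`,
Gross–Zagier–Kolyvagin, modularity, Cassels' isogeny invariance of the BSD quotient
`bsdRHS_eq_of_isIsogenous`). Closes nothing: the crux stays the `μ`-part of Kato's divisibility at `2`.

WHAT IS PROVED (planner's typed target ISO-μ@2, STATUS 2026-08-26T05:13:14Z, in a degree-free form;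
print has the isogeny formula for the `μ`-invariant only for ODD `p` — Schneider 1987, Perrin-Riou;
Greenberg LNM 1716 p. 64 — and at `p = 2` states «conjecturally `μ_E = m_E`», p. 170):

* §3 `mu_add_padicValRat_eq_of_isIsogenous` — **the `2`-adic isogeny formula at analytic rank `0`.**
  For `ℚ`-isogenous globally minimal `E ∼ E'`, good ordinary at `2`, `r_an = 0`, a common newform `f`
  (any level) with Néron ratios `ϖ·Ω_E = Ω⁺_f = ϖ'·Ω_{E'}`, the cyclotomic `ℤ₂`-extension and dual data
  `D, D'` with `X(E/ℚ_∞)` torsion: **`μ(E') − μ(E) = ord₂ ϖ' − ord₂ ϖ`** (`= ord₂(Ω_E/Ω_{E'})`).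
  Proof: ord-3's rank-`0` dictionary `exists_shaAn_eq_and_valuation_constantCoeff_charGen_eq` at BOTH
  curves with the SAME integral `L₀ = L₂(f, α)` (INT2-AUTO `exists_iwasawaToPowerSeries_eq_padicLFunction_two_auto`,
  `α` is an isogeny invariant), Cassels (`finite_sha_and_shaAn_eq_of_isIsogenous`: `ord₂ #Ш − ord₂ #Ш_an`
  is an isogeny invariant), and the algebra of file 1 (`ord₂ f_{X'}(0) + μ = ord₂ f_X(0) + μ'`).
* §4 **`mainConjectureLowerDivisibilityAtTwoOrd_of_isIsogenous` — the Kato half TRANSPORTS along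
  isogenies at analytic rank `0`**: PUB + `X5.O1.MainConjectureLowerDivisibilityAtTwoOrd W` + `W ∼ W'`
  ⇒ `X5.O1.MainConjectureLowerDivisibilityAtTwoOrd W'` (level = conductor from modularity,
  `IsNewformOf.level_eq_conductorNorm_of_exists_conductorLevel`; the Néron ratio of `W` from Cassels;
  `2^{μ'}·g ∈ char X·(2^{μ'}) = char X'·(2^{μ})`). So the `μ`-invariant MOVES inside an isogeny class
  (Greenberg Prop. 5.13) but the analytic `μ` moves with it, and `μ(X) ≤ μ(ϖ·L₂)` is member-independent.
* §5 **`ordKatoHalfAtTwo_iff_ordKatoHalfAtTwoIso`**: modulo `OrdPublishedInputsAtTwo` (item 19149) and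
  Cassels, the served crux 19271 `OrdKatoHalfAtTwo` (∀ members) and its up-to-isogeny repair 19573
  `OrdKatoHalfAtTwoIso` (∃ a member) are EQUIVALENT: the ∀-member form carries NO extra content
  «`μ_E = m_E` at 2» — one member per isogeny class (the optimal / Prop-5.14 / GVI / TOWER member)
  decides the crux for the class, with no per-member `λ`/`μ` certificate.

What this is NOT: not the Kato half itself (open off the `μ = 0` habitat); not an isogeny formula at
analytic rank `≥ 1` (no `2`-adic height / Perrin-Riou leading term at `2` in the tree); not a claim
about additive or multiplicative `2`.

References: R. Greenberg, LNM 1716 (1999), Thm. 4.1, §1 p. 64, Props. 5.13–5.14 and p. 170;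
K. Kato, Astérisque 295 (2004), Thm. 17.4; J. W. S. Cassels, J. reine angew. Math. 217 (1965);
J. Milne, *Arithmetic Duality Theorems*, Thm. I.7.3; P. Schneider, J. Indian Math. Soc. 52 (1987);
B. Perrin-Riou, Invent. Math. 99 (1990).
-/

set_option autoImplicit false

noncomputable section

open scoped Classical MatrixGroups ModularForm

open CongruenceSubgroup WeierstrassCurve Literature.NumberTheory.EllipticCurves
  Literature.NumberTheory.EllipticCurves.ModularForms Literature.NumberTheory.EllipticCurves.Rank1Residual
  Literature.NumberTheory.EllipticCurves.Rank1Residual.Typed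
  Summit.BirchSwinnertonDyer.Rank1Residual Summit.BirchSwinnertonDyer.Rank1Residual.X5
  Summit.BirchSwinnertonDyer.Rank1Residual.X2.IsogenyLineTypeGoodOrdinary
  Summit.BirchSwinnertonDyer.BirchSwinnertonDyer.Theorems.EisensteinShaCurrency

namespace Summit.BirchSwinnertonDyer.BirchSwinnertonDyer.Theorems.KatoHalfIsogeny

/-! ## §3 The `2`-adic isogeny formula at analytic rank `0` -/

section Formula

variable {W W' : WeierstrassCurve ℚ} [W.IsElliptic] [W'.IsElliptic] [W.IsGloballyMinimal]
  [W'.IsGloballyMinimal]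

/-- Cusp forms move along an equality of levels, keeping `plusPeriod`, `padicLFunction` and
`IsNewformOf` (a `subst`; used to read a newform of `E'` at level `N_{E'} = N_E` as a form of level
`N_E`). [folklore] -/
theorem exists_levelCast {N N' : ℕ} [NeZero N] [NeZero N'] (h : N = N') (f : CuspForm (Gamma0 N) 2) :
    ∃ g : CuspForm (Gamma0 N') 2, plusPeriod g = plusPeriod f ∧
      (∀ α : ℚ_[2], padicLFunction g α = padicLFunction f α) ∧
      ∀ (V : WeierstrassCurve ℚ), IsNewformOf V g ↔ IsNewformOf V f := by
  subst h
  exact ⟨f, rfl, fun _ => rfl, fun _ => Iff.rfl⟩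

/-- **The Néron ratio of an isogenous curve (Cassels).** For `ℚ`-isogenous globally minimal `E ∼ E'`
of analytic rank `0` and a Néron ratio `ϖ'` of `E'` (`ϖ'·Ω_{E'} = Ω⁺_f`), the rational
`ϖ := ϖ' · (#Ш(E)·∏c(E)·#E'(ℚ)²)/(#Ш(E')·∏c(E')·#E(ℚ)²)` is a Néron ratio of `E` (`ϖ·Ω_E = Ω⁺_f`):
Cassels' invariance `#Ш·Ω·∏c/#E(ℚ)²` (regulators `= 1` at rank `0`, GZK) gives
`Ω_E/Ω_{E'} ∈ ℚ^×`. [cite: MilneADT2006, Thm. I.7.3] [cite: Cassels1965ArithmeticVIII] -/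
theorem exists_neronRatio_of_isIsogenous (hGZK : rank_eq_analyticRank_of_analyticRank_le_one)
    (hCassels : bsdRHS_eq_of_isIsogenous) (hiso : IsIsogenous W W') (hr : W.analyticRank = 0)
    {N : ℕ} [NeZero N] {f : CuspForm (Gamma0 N) 2} {ϖ' : ℚ}
    (hϖ' : (ϖ' : ℝ) * W'.realPeriodRat = plusPeriod f) :
    ∃ ϖ : ℚ, (ϖ : ℝ) * W.realPeriodRat = plusPeriod f := by
  have hr' : W'.analyticRank = 0 := by rw [← analyticRank_eq_of_isIsogenous' hiso, hr]
  obtain ⟨hrank, hfin⟩ := hGZK W (by rw [hr]; exact zero_le_one)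
  obtain ⟨hrank', hfin'⟩ := hGZK W' (by rw [hr']; exact zero_le_one)
  have hmw : W.mordellWeilRank = 0 := by rw [hrank, hr]
  have hmw' : W'.mordellWeilRank = 0 := by rw [hrank', hr']
  obtain ⟨-, hRHS⟩ := hCassels W W' hiso hfin
  rw [bsdRHS_def, bsdRHS_def, W.regulator_eq_one_of_rank_zero hmw,
    W'.regulator_eq_one_of_rank_zero hmw', mul_one, mul_one] at hRHS
  have hΩ' : 0 < W'.realPeriodRat := W'.realPeriodRat_pos_holds
  have hS : (0 : ℝ) < W.shaOrder := by exact_mod_cast W.shaOrder_pos hfin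
  have hS' : (0 : ℝ) < W'.shaOrder := by exact_mod_cast W'.shaOrder_pos hfin'
  have hT : (0 : ℝ) < W.tamagawaProduct := by exact_mod_cast W.tamagawaProduct_pos'
  have hT' : (0 : ℝ) < W'.tamagawaProduct := by exact_mod_cast W'.tamagawaProduct_pos'
  haveI := W.finite_point_of_rank_zero hmw
  haveI := W'.finite_point_of_rank_zero hmw'
  have ht : (0 : ℝ) < W.torsionOrder := by
    rw [W.torsionOrder_eq_natCard_of_finite]; exact_mod_cast Nat.card_pos
  have ht' : (0 : ℝ) < W'.torsionOrder := by
    rw [W'.torsionOrder_eq_natCard_of_finite]; exact_mod_cast Nat.card_pos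
  rw [div_eq_div_iff (pow_ne_zero 2 ht'.ne') (pow_ne_zero 2 ht.ne')] at hRHS
  -- `Ω_E = r · Ω_{E'}` with the rational `r`
  set r : ℚ := (W'.shaOrder : ℚ) * W'.tamagawaProduct * (W.torsionOrder : ℚ) ^ 2 /
    ((W.shaOrder : ℚ) * W.tamagawaProduct * (W'.torsionOrder : ℚ) ^ 2) with hr_def
  have hden : (W.shaOrder : ℝ) * W.tamagawaProduct * (W'.torsionOrder : ℝ) ^ 2 ≠ 0 := by positivity
  have hrΩ : W.realPeriodRat = (r : ℝ) * W'.realPeriodRat := by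
    rw [hr_def]
    push_cast
    rw [div_mul_eq_mul_div, eq_div_iff hden]
    linear_combination -hRHS
  have hr0 : (r : ℝ) ≠ 0 := by
    rw [hr_def]; push_cast; positivity
  refine ⟨ϖ' / r, ?_⟩
  rw [← hϖ', hrΩ]
  push_cast
  field_simp

/-- **THE `2`-ADIC ISOGENY FORMULA AT ANALYTIC RANK `0`.** Let `E ∼ E'` be `ℚ`-isogenous globally
minimal curves, good ordinary at `2`, of analytic rank `0`; `f` a newform of `E` (any level; then also
of `E'`), `ϖ, ϖ'` rationals with `ϖ·Ω_E = Ω⁺_f = ϖ'·Ω_{E'}`; `κ, γ` the cyclotomic `ℤ₂`-extension with a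
matching topological generator; `D, D'` Pontryagin-dual data with `X(E/ℚ_∞)` torsion. Granted the
PUBLISHED inputs Greenberg Thm. 4.1 AT `2` for both curves (`hEC`, `hEC'`), GZK (`hGZK`), modularity
(`hmod`) and Cassels (`hCassels`): **`μ(X(E'/ℚ_∞)) + ord₂ ϖ = μ(X(E/ℚ_∞)) + ord₂ ϖ'`**, i.e.
`μ(E') − μ(E) = ord₂(Ω_E/Ω_{E'})` — Schneider's isogeny formula, printed only for odd `p`
(Greenberg LNM 1716 p. 64), at `p = 2` and rank `0`. E.g. class 163785b: `Ω_{b4} = Ω_{b2}/2`, so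
`μ(X_{b4}) = μ(X_{b2}) + 1 = 1` (Greenberg's «`μ_E = m_E`» there, p. 170, with no certificate at b4).
[cite: GreenbergLNM1716, Thm. 4.1 (p. 102), §1 p. 64, Props. 5.13–5.14 and p. 170]
[cite: MilneADT2006, Thm. I.7.3] [cite: MazurTateTeitelbaum1986Invent, §I.14 (14.3)] -/
theorem mu_add_padicValRat_eq_of_isIsogenous (hGZK : rank_eq_analyticRank_of_analyticRank_le_one)
    (hmod : nonempty_modularParametrizationData) (hCassels : bsdRHS_eq_of_isIsogenous)
    (hEC : O1.TwoAdicEulerCharRankZero W 0) (hEC' : O1.TwoAdicEulerCharRankZero W' 0)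
    (hiso : IsIsogenous W W') (hgo : GoodOrd W 2) (hgo' : GoodOrd W' 2) (hr : W.analyticRank = 0)
    {κ : ZpExtension ℚ 2} {γ : Field.absoluteGaloisGroup ℚ} (hκ : κ.IsCyclotomic)
    (hγ : κ.IsTopGenerator γ) (hγ' : IsCyclotomicVariable 2 γ) {N : ℕ} [NeZero N]
    {f : CuspForm (Gamma0 N) 2} (hf : IsNewformOf W f) {ϖ ϖ' : ℚ}
    (hϖ : (ϖ : ℝ) * W.realPeriodRat = plusPeriod f) (hϖ' : (ϖ' : ℝ) * W'.realPeriodRat = plusPeriod f)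
    (D : W.SelmerDualData κ γ) (D' : W'.SelmerDualData κ γ) (hX : D.IsTorsion) :
    (D'.mu : ℤ) + padicValRat 2 ϖ = (D.mu : ℤ) + padicValRat 2 ϖ' := by
  have hord : IsOrdinaryAt W 2 := hgo
  have hord' : IsOrdinaryAt W' 2 := hgo'
  have hf' : IsNewformOf W' f := hf.of_isIsogenous hiso.symm_of_charZero
  have hr' : W'.analyticRank = 0 := by rw [← analyticRank_eq_of_isIsogenous' hiso, hr]
  have hL : W.entireLFunction 1 ≠ 0 := entireLFunction_one_ne_zero_of_analyticRank_eq_zero hmod W hr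
  have hL' : W'.entireLFunction 1 ≠ 0 :=
    entireLFunction_one_ne_zero_of_analyticRank_eq_zero hmod W' hr'
  haveI : Module.Finite (IwasawaAlgebra 2) D.X := D.module_finite_holds hγ
  haveI : Module.Finite (IwasawaAlgebra 2) D'.X := D'.module_finite_holds hγ
  have hX' : D'.IsTorsion := (D.isTorsion_and_charIdeal_mul_span_eq_of_isIsogenous D' hiso hγ hX).1
  -- generators of the two characteristic ideals
  obtain ⟨fX, hfX⟩ := (charIdeal_isPrincipal_holds 2 D.X).principal
  obtain ⟨fX', hfX'⟩ := (charIdeal_isPrincipal_holds 2 D'.X).principal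
  have hchar : D.charIdeal = Ideal.span {fX} := hfX
  have hchar' : D'.charIdeal = Ideal.span {fX'} := hfX'
  -- the common integral `L`-function `L₀ = L₂(f, α)` (INT2-AUTO), auxiliary ratio `1`
  obtain ⟨L₀, hL₀⟩ := exists_iwasawaToPowerSeries_eq_padicLFunction_two_auto hord hf
  have hL₀W : iwasawaToPowerSeries 2 L₀ =
      PowerSeries.C (((1 : ℚ) : ℚ) : ℚ_[2]) * padicLFunction f (unitRoot W 2 : ℚ_[2]) := by
    rw [hL₀, Rat.cast_one, map_one, one_mul]
  have hL₀W' : iwasawaToPowerSeries 2 L₀ =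
      PowerSeries.C (((1 : ℚ) : ℚ) : ℚ_[2]) * padicLFunction f (unitRoot W' 2 : ℚ_[2]) := by
    rw [← unitRoot_eq_of_isIsogenous hiso hgo.1]; exact hL₀W
  -- the two rank-0 dictionaries (Greenberg 4.1 at 2 + interpolation + GZK)
  obtain ⟨q, hq, hq0, hfX0, -, hv⟩ := exists_shaAn_eq_and_valuation_constantCoeff_charGen_eq W hEC
    hGZK hord hL hκ hγ hγ' hf D hX hϖ (one_ne_zero) hchar hL₀W
  obtain ⟨q', hq', hq'0, -, -, hv'⟩ := exists_shaAn_eq_and_valuation_constantCoeff_charGen_eq W' hEC'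
    hGZK hord' hL' hκ hγ hγ' hf' D' hX' hϖ' (one_ne_zero) hchar' hL₀W'
  -- Cassels: `#Ш_an(E) = #Ш_an(E') · #Ш(E)/#Ш(E')`
  have hfin' : Finite W'.sha := (hGZK W' (by rw [hr']; exact zero_le_one)).2
  haveI : NeZero (W'.conductorNorm ℤ) := ⟨(W'.conductorNorm_pos_holds).ne'⟩
  obtain ⟨Dm⟩ := hmod W'
  have hlead' : W'.leadingLCoeff ≠ 0 :=
    W'.leadingLCoeff_ne_zero_holds Dm.isNewformOf.hasEntireLFunction
  obtain ⟨hfin, hkey⟩ := finite_sha_and_shaAn_eq_of_isIsogenous hCassels hiso hfin' hlead'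
  haveI : Finite W.sha := hfin
  haveI : Finite W'.sha := hfin'
  have hS : (W.shaOrder : ℚ) ≠ 0 := by exact_mod_cast (W.shaOrder_pos hfin).ne'
  have hS' : (W'.shaOrder : ℚ) ≠ 0 := by exact_mod_cast (W'.shaOrder_pos hfin').ne'
  rw [hq, hq'] at hkey
  have hqq : q = q' * W.shaOrder / W'.shaOrder := by exact_mod_cast hkey
  have hvq : padicValRat 2 q = padicValRat 2 q' + padicValNat 2 W.shaOrder - padicValNat 2 W'.shaOrder := by
    rw [hqq, padicValRat.div (mul_ne_zero hq'0 hS) hS', padicValRat.mul hq'0 hS, padicValRat.of_nat,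
      padicValRat.of_nat]
  -- file 1: `ord₂ f_{X'}(0) + μ = ord₂ f_X(0) + μ'`
  obtain ⟨-, hbal⟩ := D.valuation_constantCoeff_add_mu_eq_of_isIsogenous D' hiso hγ hX hchar hchar' hfX0
  have hbalZ := congrArg (Nat.cast : ℕ → ℤ) hbal
  push_cast at hbalZ
  have h1 : padicValRat 2 (1 : ℚ) = 0 := padicValRat.one
  rw [h1] at hv hv'
  linarith

end Formula

/-! ## §4 The Kato half transports along isogenies at analytic rank `0` -/

section Transport

variable {W W' : WeierstrassCurve ℚ} [W.IsElliptic] [W'.IsElliptic] [W.IsGloballyMinimal]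
  [W'.IsGloballyMinimal]

/-- `ι (C c) = C c` for the embedding `ι : Λ = ℤ₂⟦T⟧ ↪ ℚ₂⟦T⟧`. [folklore] -/
theorem iwasawaToPowerSeries_C (c : ℤ_[2]) :
    iwasawaToPowerSeries 2 (PowerSeries.C c) = PowerSeries.C (c : ℚ_[2]) := by
  rw [iwasawaToPowerSeries, PowerSeries.map_C]
  rfl

/-- **THE KATO HALF IS AN ISOGENY-CLASS STATEMENT AT ANALYTIC RANK `0`.** Let `E ∼ E'` be
`ℚ`-isogenous globally minimal curves, good ordinary at `2`, `r_an(E) = 0`. Granted the PUBLISHED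
inputs GZK (`hGZK`), modularity (`hmod`), Cassels (`hCassels`), Kato 17.4 (1)(2) AT `2` for `E` (`h17`,
only clause (1): `X(E/ℚ_∞)` torsion) and Greenberg Thm. 4.1 AT `2` for both curves (`hEC`, `hEC'`):
`X5.O1.MainConjectureLowerDivisibilityAtTwoOrd W → X5.O1.MainConjectureLowerDivisibilityAtTwoOrd W'`.
Proof: a newform `f'` of `E'` at level `N_{E'}` is a newform of `E` (`IsNewformOf.of_isIsogenous`),
`N_{E'} = N_E` by strong multiplicity one against `E`'s modular parametrisation
(`IsNewformOf.level_eq_conductorNorm_of_exists_conductorLevel`); the Néron ratio `ϖ` of `E` exists by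
Cassels (`exists_neronRatio_of_isIsogenous`); the Kato half at `E` gives `g ∈ char X` with
`ι g = ϖ·L₂(f', α)` (`α` is an isogeny invariant); by file 1, `2^{μ'}·g ∈ char X·(2^{μ'}) =
char X'·(2^{μ})`, so `2^{μ'}·g = 2^{μ}·g₁` with `g₁ ∈ char X'`; by §3 `u := ϖ'·2^{μ}/(ϖ·2^{μ'})` is a
`2`-adic unit, and `g' := u·g₁ ∈ char X'` has `ι g' = ϖ'·L₂(f', α)`.
[cite: Kato2004Asterisque, Thm. 17.4 (1)(2) (p. 273)] [cite: GreenbergLNM1716, Thm. 4.1 (p. 102), §1 p. 64]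
[cite: MilneADT2006, Thm. I.7.3] [cite: AtkinLehner1970, Thm. 4] -/
theorem mainConjectureLowerDivisibilityAtTwoOrd_of_isIsogenous
    (hGZK : rank_eq_analyticRank_of_analyticRank_le_one) (hmod : nonempty_modularParametrizationData)
    (hCassels : bsdRHS_eq_of_isIsogenous)
    (h17 : ∀ [NeZero (W.conductorNorm ℤ)] (f : CuspForm (Gamma0 (W.conductorNorm ℤ)) 2),
      kato_divisibility_allPrimes W 2 (f := f))
    (hEC : O1.TwoAdicEulerCharRankZero W 0) (hEC' : O1.TwoAdicEulerCharRankZero W' 0)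
    (hiso : IsIsogenous W W') (hgo : GoodOrd W 2) (hgo' : GoodOrd W' 2) (hr : W.analyticRank = 0)
    (h : O1.MainConjectureLowerDivisibilityAtTwoOrd W) :
    O1.MainConjectureLowerDivisibilityAtTwoOrd W' := by
  intro κ γ hκ hγ hγ' hord' _ f' hf' ϖ' hϖ' D'
  have hord : IsOrdinaryAt W 2 := hgo
  -- the newform of `E'` is a newform of `E`, at level `N_{E'} = N_E`
  have hf'W : IsNewformOf W f' := hf'.of_isIsogenous hiso
  haveI : NeZero (W.conductorNorm ℤ) := ⟨(W.conductorNorm_pos_holds).ne'⟩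
  obtain ⟨Dm⟩ := hmod W
  have hN : W'.conductorNorm ℤ = W.conductorNorm ℤ :=
    IsNewformOf.level_eq_conductorNorm_of_exists_conductorLevel ⟨_, Dm.isNewformOf⟩ hf'W
  obtain ⟨g, hgper, hgL, hgnew⟩ := exists_levelCast hN f'
  have hgW : IsNewformOf W g := (hgnew W).mpr hf'W
  -- the Néron ratio of `E` (Cassels) and a dual datum for `E`
  obtain ⟨ϖ, hϖ⟩ := exists_neronRatio_of_isIsogenous hGZK hCassels hiso hr hϖ'
  obtain ⟨D⟩ := W.nonempty_selmerDualData_holds κ γ hγ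
  have hX : D.IsTorsion := (h17 g κ γ hκ hγ hγ' hord hgW D).1
  haveI : Module.Finite (IwasawaAlgebra 2) D.X := D.module_finite_holds hγ
  haveI : Module.Finite (IwasawaAlgebra 2) D'.X := D'.module_finite_holds hγ
  -- the Kato half at `E`, read for the form `g` (= `f'` at level `N_E`) and `ϖ`
  obtain ⟨g₀, hg₀, hι⟩ := h κ γ hκ hγ hγ' hord g hgW ϖ (by rw [hgper]; exact hϖ) D
  rw [hgL, unitRoot_eq_of_isIsogenous hiso hgo.1] at hι
  -- the isogeny formula and the characteristic ideals along the isogeny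
  have hμ := mu_add_padicValRat_eq_of_isIsogenous hGZK hmod hCassels hEC hEC' hiso hgo hgo' hr hκ hγ
    hγ' hf'W hϖ hϖ' D D' hX
  obtain ⟨-, key⟩ := D.isTorsion_and_charIdeal_mul_span_eq_of_isIsogenous D' hiso hγ hX
  have hmem : g₀ * PowerSeries.C (((2 : ℕ) : ℤ_[2]) ^ D'.mu) ∈
      D'.charIdeal * Ideal.span {PowerSeries.C (((2 : ℕ) : ℤ_[2]) ^ D.mu)} := by
    rw [key]
    exact Ideal.mul_mem_mul hg₀ (Ideal.mem_span_singleton_self _)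
  obtain ⟨g₁, hg₁, hg₁eq⟩ := Ideal.mem_mul_span_singleton.mp hmem
  -- the `2`-adic unit `u = ϖ'·2^{μ}/(ϖ·2^{μ'})`
  have hϖ0 : ϖ ≠ 0 := X2.varpi_ne_zero_of_isNewformOf hf'W hϖ
  have hϖ'0 : ϖ' ≠ 0 := X2.varpi_ne_zero_of_isNewformOf hf' hϖ'
  have h20 : (2 : ℚ) ≠ 0 := two_ne_zero
  set u : ℚ := ϖ' * 2 ^ D.mu / (ϖ * 2 ^ D'.mu) with hu_def
  have hu0 : u ≠ 0 := by
    rw [hu_def]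
    exact div_ne_zero (mul_ne_zero hϖ'0 (pow_ne_zero _ h20)) (mul_ne_zero hϖ0 (pow_ne_zero _ h20))
  have h22 : padicValRat 2 (2 : ℚ) = 1 := by exact_mod_cast padicValRat.self (p := 2) (by norm_num)
  have hvu : padicValRat 2 u = 0 := by
    rw [hu_def, padicValRat.div (mul_ne_zero hϖ'0 (pow_ne_zero _ h20))
      (mul_ne_zero hϖ0 (pow_ne_zero _ h20)), padicValRat.mul hϖ'0 (pow_ne_zero _ h20),
      padicValRat.mul hϖ0 (pow_ne_zero _ h20), padicValRat.pow (2 : ℚ), padicValRat.pow (2 : ℚ), h22]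
    linarith
  have hnorm : ‖((u : ℚ) : ℚ_[2])‖ ≤ 1 := by
    have huQ : ((u : ℚ) : ℚ_[2]) ≠ 0 := by exact_mod_cast hu0
    rw [Padic.norm_eq_zpow_neg_valuation huQ, Padic.valuation_ratCast, hvu, neg_zero, zpow_zero]
  let u₀ : ℤ_[2] := ⟨((u : ℚ) : ℚ_[2]), hnorm⟩
  refine ⟨PowerSeries.C u₀ * g₁, Ideal.mul_mem_left _ _ hg₁, ?_⟩
  -- `ι(C u₀ · g₁) = ϖ'·L₂(f', α')`: cancel the non-zero-divisor `C(2^{μ})`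
  have hc : ((((2 : ℕ) : ℤ_[2]) ^ D.mu : ℤ_[2]) : ℚ_[2]) = (2 : ℚ_[2]) ^ D.mu := by
    norm_cast
  have hc' : ((((2 : ℕ) : ℤ_[2]) ^ D'.mu : ℤ_[2]) : ℚ_[2]) = (2 : ℚ_[2]) ^ D'.mu := by
    norm_cast
  have hιeq : iwasawaToPowerSeries 2 g₁ * PowerSeries.C ((2 : ℚ_[2]) ^ D.mu) =
      PowerSeries.C ((2 : ℚ_[2]) ^ D'.mu) * (PowerSeries.C (ϖ : ℚ_[2]) *
        padicLFunction f' (unitRoot W' 2 : ℚ_[2])) := by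
    have := congrArg (iwasawaToPowerSeries 2) hg₁eq
    rw [map_mul, map_mul, iwasawaToPowerSeries_C, iwasawaToPowerSeries_C, hι, hc, hc'] at this
    rw [this, mul_comm]
  have hC0 : (PowerSeries.C ((2 : ℚ_[2]) ^ D.mu) : PowerSeries ℚ_[2]) ≠ 0 := by
    intro h0
    have h1 := congrArg PowerSeries.constantCoeff h0
    rw [PowerSeries.constantCoeff_C, map_zero] at h1
    exact pow_ne_zero _ two_ne_zero h1
  apply mul_right_cancel₀ hC0
  have huq : ((u : ℚ) : ℚ_[2]) * (2 : ℚ_[2]) ^ D'.mu * (ϖ : ℚ_[2]) =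
      (ϖ' : ℚ_[2]) * (2 : ℚ_[2]) ^ D.mu := by
    have huq' : u * 2 ^ D'.mu * ϖ = ϖ' * 2 ^ D.mu := by
      rw [hu_def]; field_simp
    have := congrArg (Rat.cast : ℚ → ℚ_[2]) huq'
    push_cast at this
    exact this
  have hu₀ : ((u₀ : ℤ_[2]) : ℚ_[2]) = ((u : ℚ) : ℚ_[2]) := rfl
  rw [map_mul, iwasawaToPowerSeries_C, hu₀, mul_assoc, hιeq]
  have hre : PowerSeries.C ((u : ℚ) : ℚ_[2]) * (PowerSeries.C ((2 : ℚ_[2]) ^ D'.mu) *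
      (PowerSeries.C (ϖ : ℚ_[2]) * padicLFunction f' (unitRoot W' 2 : ℚ_[2]))) =
        PowerSeries.C (((u : ℚ) : ℚ_[2]) * (2 : ℚ_[2]) ^ D'.mu * (ϖ : ℚ_[2])) *
          padicLFunction f' (unitRoot W' 2 : ℚ_[2]) := by
    simp only [map_mul]; ring
  rw [hre, huq, map_mul]
  ring

end Transport

/-! ## §5 The served crux 19271 and its up-to-isogeny repair 19573 are equivalent modulo PUB -/

section Route

open Summit.BirchSwinnertonDyer.BirchSwinnertonDyer.Theses.ByReductionTypeAtTwo

/-- **19573 ⇒ 19271 modulo PUB**: the Kato half at SOME globally minimal member of each isogeny class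
(`OrdKatoHalfAtTwoIso`) gives it at EVERY member (`OrdKatoHalfAtTwo`), granted the route's published
inputs `OrdPublishedInputsAtTwo` (modularity, GZK, Kato 17.4 (1)(2)@2, Greenberg 4.1@2) and Cassels'
isogeny invariance `bsdRHS_eq_of_isIsogenous`. Good ordinary reduction at `2` and analytic rank `0`
transport along the isogeny (`hasGoodReductionAtPrime_of_isIsogenous`,
`not_dvd_frobeniusTrace_of_isIsogenous`, `analyticRank_eq_of_isIsogenous'`).
[cite: GreenbergLNM1716, Thm. 4.1 (p. 102), §1 p. 64] [cite: MilneADT2006, Thm. I.7.3] -/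
theorem ordKatoHalfAtTwo_of_ordKatoHalfAtTwoIso (hPub : OrdPublishedInputsAtTwo)
    (hCassels : bsdRHS_eq_of_isIsogenous) (hK : OrdKatoHalfAtTwoIso) : OrdKatoHalfAtTwo := by
  obtain ⟨hmod, hGZK, h17, hGr⟩ := hPub
  intro W _ _ hcm hr hgo
  obtain ⟨W', _, _, hiso, hK'⟩ := hK W hcm hr hgo
  have hgo' : GoodOrd W' 2 :=
    ⟨hasGoodReductionAtPrime_of_isIsogenous hiso hgo.1,
      not_dvd_frobeniusTrace_of_isIsogenous hiso hgo.1 hgo.2⟩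
  have hr' : W'.analyticRank = 0 := by rw [← analyticRank_eq_of_isIsogenous' hiso, hr]
  exact mainConjectureLowerDivisibilityAtTwoOrd_of_isIsogenous hGZK hmod hCassels (fun f => h17 W' f)
    (O1.twoAdicEulerCharRankZero_zero_of_greenberg W' hGr)
    (O1.twoAdicEulerCharRankZero_zero_of_greenberg W hGr) hiso.symm_of_charZero hgo' hgo hr' hK'

/-- 19271 ⇒ 19573 (take `W' := W`). [folklore] -/
theorem ordKatoHalfAtTwoIso_of_ordKatoHalfAtTwo (h : OrdKatoHalfAtTwo) : OrdKatoHalfAtTwoIso :=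
  fun W _ _ hcm hr hgo =>
    ⟨W, inferInstance, inferInstance, WeierstrassCurve.isIsogenous_self W, h W hcm hr hgo⟩

/-- **19271 ⟺ 19573 modulo PUB + Cassels**: the ∀-member Kato half carries no content beyond the
one-member form (no «`μ_E = m_E` at 2» at non-distinguished members). [cite: GreenbergLNM1716, §1 p. 64, p. 170] -/
theorem ordKatoHalfAtTwo_iff_ordKatoHalfAtTwoIso (hPub : OrdPublishedInputsAtTwo)
    (hCassels : bsdRHS_eq_of_isIsogenous) : OrdKatoHalfAtTwo ↔ OrdKatoHalfAtTwoIso :=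
  ⟨ordKatoHalfAtTwoIso_of_ordKatoHalfAtTwo, ordKatoHalfAtTwo_of_ordKatoHalfAtTwoIso hPub hCassels⟩

end Route

end Summit.BirchSwinnertonDyer.BirchSwinnertonDyer.Theorems.KatoHalfIsogeny

end
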